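import Literature.MathematicalPhysics.QuantumLattice.EmeryThreeBandThermalPressure
import HarnessLib

/-!
# Directional Griffiths brackets for periodic equilibria of LINEAR FAMILIES, and the three-band densities at `T > 0`:
# the Cu / O occupations and the electron count per `CuO₂` of every equilibrium from four certified pressures

Topic `Literature/MathematicalPhysics/QuantumLattice` (family `hubbard`; crew hubbard-fast S2 «multi-band × T > 0», seat hubbard-box-p1). Sequel of
`EmeryThreeBandThermalPressure` (§5 there: brackets along ONE coupling coordinate `θ_a`). A chemical potential of the three-band model is NOT a
coordinate direction of `θ ∈ ℝ¹⁴` but the diagonal shift of the three site energies (`θ₈, θ₉, θ₁₀` = Cu, O_x, O_y levels); the conjugate density is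
the electron count per cell. This file supplies the directional form:

* §1 (generic, every `q`-periodic linear family `Ψ₀ + Σ_a θ_a Ψ_a` on `ℤ^d`) **`IsPerVarEquilibrium.perVarPressure_sub_mul_sum_le_add_smul`**: for an
  equilibrium `ω` at `(β, θ)`, every direction `d` and real `δ`, `P_q(θ) − βδ·Σ_a d_a ē_a(ω) ≤ P_q(θ + δd)` (master tangent inequality); hence for
  `β, δ > 0` the two-sided bracket `(P_q(θ) − P_q(θ+δd))/(βδ) ≤ Σ_a d_a ē_a(ω) ≤ (P_q(θ−δd) − P_q(θ))/(βδ)` (`…sum_mul_cellMeanEnergy_mem_Icc`) and its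
  certified-number form (`…_of_bounds`: floor at `θ`, caps at `θ ± δd`).
* §2 (three-band) the occupation atoms are densities: `ē_8(ω) = ρ_Cu(ω)/4`, `ē_9 = ρ_{O_x}/4`, `ē_10 = ρ_{O_y}/4` (per site of the decorated lattice;
  `cellMeanEnergy_emeryAtoms_8/9/10`); **`emery_electronCount_mem_Icc_of_bounds`**: with the level direction `emeryLevelDir` (`1` on `8, 9, 10`, else `0`),
  the electron count per `CuO₂` of EVERY `2×2`-periodic equilibrium at `(β,θ)`, `n(ω) = ρ_Cu + ρ_{O_x} + ρ_{O_y}`, satisfies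
  `4(L − U₊)/(βδ) ≤ n(ω) ≤ 4(U₋ − L)/(βδ)` from a floor `L ≤ emeryPressure β θ` and caps `emeryPressure β (θ ± δ·emeryLevelDir) ≤ U_±`
  (raising all three levels by `δ` = lowering the chemical potential by `δ`); the Cu occupation alone: `emery_cuDensity_mem_Icc_of_bounds`.

Everything is PROVED (0 sorry); the one definition (`emeryLevelDir`) has a body. HONEST SCOPE: brackets, no number; the hole count of cuprate
bookkeeping is `5 − n` per `CuO₂` (filling `ρ = n/4` per site of the decorated lattice in the tree's `emeryStates` convention, dummy empty).

## Tree / Mathlib search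

REUSED: `IsPerVarEquilibrium(.perVarPressure_add_le)`, `cellMeanEnergy_linearFamily_eq_add_sum_sub_mul` (`PeriodicVariationalEquilibria`); `emeryPressure(_eq_linearFamily)`
(`EmeryThreeBandThermalPressure`); `emeryAtoms`, `cuSite/oxSite/oySite`, `liebPeriods` (`EmeryThreeBand*`); `cellMeanEnergy_sublatticeOnSite_one_zero`
(`PeriodicSublatticeAndStaggeredTerms`); `densityAt`. `lean search 'smul.*perVarPressure_sub_mul_sum|LevelDir'` (Literature): only the single-coordinate
`perVarPressure_sub_mul_le_update`; `Downfold.EmeryReferenceLevel.levelDir` lives in the Summits tree (not importable here).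

## References

* R. B. Griffiths, J. Math. Phys. 5 (1964) 1215, eq. (39) (tangent brackets). [cite: Griffiths1964, Eq. (39) and Fig. 3]
* R. B. Israel, *Convexity in the Theory of Lattice Gases* (1979), Thm. I.2.4. [cite: Israel1979, Thm. I.2.4]
* V. J. Emery, Phys. Rev. Lett. 58 (1987) 2794. [cite: Emery1987, eq. (1)]
-/

noncomputable section

open scoped ComplexOrder BigOperators
open Finset

namespace Literature.MathematicalPhysics.QuantumLattice

open Matrix HubbardWave0 Literature.Probability.LatticeModels ThermodynamicLimit

/-! ### §1. Directional brackets for periodic equilibria of a linear family -/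

namespace InfVolFermionState

section Directional

variable {d : ℕ} {q : Fin d → ℕ} {ι : Type*} [Fintype ι] {Ψ₀ : FermionInteraction d} {Ψv : ι → FermionInteraction d} {β R : ℝ}
  {θ : ι → ℝ} {ω : InfVolFermionState d}

/-- **MASTER INEQUALITY ALONG A DIRECTION**: for a periodic equilibrium `ω` at `(β, θ)` of the linear family, every direction `d` and real `δ`:
`P_q(θ) − βδ Σ_a d_a ē_a(ω) ≤ P_q(θ + δd)`. [cite: Israel1979, Thm. I.2.4] -/
theorem IsPerVarEquilibrium.perVarPressure_sub_mul_sum_le_add_smul (h : ω.IsPerVarEquilibrium β q (FermionInteraction.linearFamily Ψ₀ Ψv θ) R)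
    (dir : ι → ℝ) (δ : ℝ) :
    (FermionInteraction.linearFamily Ψ₀ Ψv θ).perVarPressure β q R - β * δ * ∑ a, dir a * cellMeanEnergy q (Ψv a) ω R ≤
      (FermionInteraction.linearFamily Ψ₀ Ψv (θ + δ • dir)).perVarPressure β q R := by
  have hm := h.perVarPressure_add_le β (FermionInteraction.linearFamily Ψ₀ Ψv (θ + δ • dir)) R
  rw [cellMeanEnergy_linearFamily_eq_add_sum_sub_mul Ψ₀ Ψv (θ + δ • dir) θ ω R] at hm
  have hs : ∑ a, ((θ + δ • dir) a - θ a) * cellMeanEnergy q (Ψv a) ω R = δ * ∑ a, dir a * cellMeanEnergy q (Ψv a) ω R := by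
    rw [Finset.mul_sum]
    refine Finset.sum_congr rfl fun a _ => ?_
    simp only [Pi.add_apply, Pi.smul_apply, smul_eq_mul]
    ring
  rw [hs] at hm
  linarith

/-- **DIRECTIONAL GRIFFITHS BRACKET** (`β, δ > 0`): `(P_q(θ) − P_q(θ+δd))/(βδ) ≤ Σ_a d_a ē_a(ω) ≤ (P_q(θ−δd) − P_q(θ))/(βδ)`.
[cite: Griffiths1964, Eq. (39) and Fig. 3] [cite: Israel1979, Thm. I.2.4] -/
theorem IsPerVarEquilibrium.sum_mul_cellMeanEnergy_mem_Icc (hβ : 0 < β)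
    (h : ω.IsPerVarEquilibrium β q (FermionInteraction.linearFamily Ψ₀ Ψv θ) R) (dir : ι → ℝ) {δ : ℝ} (hδ : 0 < δ) :
    ∑ a, dir a * cellMeanEnergy q (Ψv a) ω R ∈ Set.Icc
      (((FermionInteraction.linearFamily Ψ₀ Ψv θ).perVarPressure β q R -
          (FermionInteraction.linearFamily Ψ₀ Ψv (θ + δ • dir)).perVarPressure β q R) / (β * δ))
      (((FermionInteraction.linearFamily Ψ₀ Ψv (θ + (-δ) • dir)).perVarPressure β q R -
          (FermionInteraction.linearFamily Ψ₀ Ψv θ).perVarPressure β q R) / (β * δ)) := by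
  have hβδ : 0 < β * δ := mul_pos hβ hδ
  have hup := h.perVarPressure_sub_mul_sum_le_add_smul dir δ
  have hdn := h.perVarPressure_sub_mul_sum_le_add_smul dir (-δ)
  constructor
  · rw [div_le_iff₀ hβδ]; linarith
  · rw [le_div_iff₀ hβδ]; linarith

/-- **FROM CERTIFIED NUMBERS**: a floor `L ≤ P_q(θ)` and caps `P_q(θ ± δd) ≤ U_±` give `(L − U₊)/(βδ) ≤ Σ_a d_a ē_a(ω) ≤ (U₋ − L)/(βδ)`.
[cite: Griffiths1964, Eq. (39) and Fig. 3] -/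
theorem IsPerVarEquilibrium.sum_mul_cellMeanEnergy_mem_Icc_of_bounds (hβ : 0 < β)
    (h : ω.IsPerVarEquilibrium β q (FermionInteraction.linearFamily Ψ₀ Ψv θ) R) (dir : ι → ℝ) {δ : ℝ} (hδ : 0 < δ) {L Uplus Uminus : ℝ}
    (hL : L ≤ (FermionInteraction.linearFamily Ψ₀ Ψv θ).perVarPressure β q R)
    (hUp : (FermionInteraction.linearFamily Ψ₀ Ψv (θ + δ • dir)).perVarPressure β q R ≤ Uplus)
    (hUm : (FermionInteraction.linearFamily Ψ₀ Ψv (θ + (-δ) • dir)).perVarPressure β q R ≤ Uminus) :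
    ∑ a, dir a * cellMeanEnergy q (Ψv a) ω R ∈ Set.Icc ((L - Uplus) / (β * δ)) ((Uminus - L) / (β * δ)) := by
  have hw := h.sum_mul_cellMeanEnergy_mem_Icc hβ dir hδ
  have hβδ : 0 < β * δ := mul_pos hβ hδ
  constructor
  · exact le_trans (div_le_div_of_nonneg_right (by linarith) hβδ.le) hw.1
  · exact le_trans hw.2 (div_le_div_of_nonneg_right (by linarith) hβδ.le)

end Directional

end InfVolFermionState

/-! ### §2. The three-band densities -/

open InfVolFermionState

/-- **The level direction** of the three-band coupling space: `1` on the three site-energy coordinates (Cu `8`, O_x `9`, O_y `10`), `0` elsewhere —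
raising all levels by `δ` along it lowers the chemical potential by `δ`. [cite: Emery1987, eq. (1)] -/
def emeryLevelDir : Fin 14 → ℝ := fun a => if a = 8 ∨ a = 9 ∨ a = 10 then 1 else 0

/-- The Cu level atom is the Cu density: `ē_8(ω) = ρ_Cu(ω)/4`. [cite: PavariniEtAl2001, eq. (1)] -/
theorem cellMeanEnergy_emeryAtoms_8 (ω : InfVolFermionState 2) (R : ℝ) :
    cellMeanEnergy liebPeriods (emeryAtoms 8) ω R = (1 / 4 : ℝ) * ω.densityAt cuSite := by
  have h8 : emeryAtoms 8 = sublatticeOnSite liebPeriods cuSite 1 0 := rfl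
  have hc : cellPos (cellRes liebPeriods cuSite) = cuSite := by decide
  rw [h8, cellMeanEnergy_sublatticeOnSite_one_zero, card_cell_liebPeriods_eq, hc]
  norm_num

/-- The O_x level atom is the O_x density: `ē_9(ω) = ρ_{O_x}(ω)/4`. [cite: PavariniEtAl2001, eq. (1)] -/
theorem cellMeanEnergy_emeryAtoms_9 (ω : InfVolFermionState 2) (R : ℝ) :
    cellMeanEnergy liebPeriods (emeryAtoms 9) ω R = (1 / 4 : ℝ) * ω.densityAt oxSite := by
  have h9 : emeryAtoms 9 = sublatticeOnSite liebPeriods oxSite 1 0 := rfl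
  have hc : cellPos (cellRes liebPeriods oxSite) = oxSite := by decide
  rw [h9, cellMeanEnergy_sublatticeOnSite_one_zero, card_cell_liebPeriods_eq, hc]
  norm_num

/-- The O_y level atom is the O_y density: `ē_10(ω) = ρ_{O_y}(ω)/4`. [cite: PavariniEtAl2001, eq. (1)] -/
theorem cellMeanEnergy_emeryAtoms_10 (ω : InfVolFermionState 2) (R : ℝ) :
    cellMeanEnergy liebPeriods (emeryAtoms 10) ω R = (1 / 4 : ℝ) * ω.densityAt oySite := by
  have h10 : emeryAtoms 10 = sublatticeOnSite liebPeriods oySite 1 0 := rfl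
  have hc : cellPos (cellRes liebPeriods oySite) = oySite := by decide
  rw [h10, cellMeanEnergy_sublatticeOnSite_one_zero, card_cell_liebPeriods_eq, hc]
  norm_num

/-- **Along the level direction the conjugate density is the electron count per `CuO₂` over four**:
`Σ_a emeryLevelDir a · ē_a(ω) = (ρ_Cu + ρ_{O_x} + ρ_{O_y})(ω)/4`. [cite: Emery1987, eq. (1)] -/
theorem sum_emeryLevelDir_mul_cellMeanEnergy (ω : InfVolFermionState 2) (R : ℝ) :
    ∑ a, emeryLevelDir a * cellMeanEnergy liebPeriods (emeryAtoms a) ω R =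
      (1 / 4 : ℝ) * (ω.densityAt cuSite + ω.densityAt oxSite + ω.densityAt oySite) := by
  have hterm : ∀ a : Fin 14, emeryLevelDir a * cellMeanEnergy liebPeriods (emeryAtoms a) ω R =
      if a ∈ ({8, 9, 10} : Finset (Fin 14)) then cellMeanEnergy liebPeriods (emeryAtoms a) ω R else 0 := by
    intro a
    have hmem : a ∈ ({8, 9, 10} : Finset (Fin 14)) ↔ (a = 8 ∨ a = 9 ∨ a = 10) := by
      simp only [Finset.mem_insert, Finset.mem_singleton]
    unfold emeryLevelDir
    by_cases ha : a = 8 ∨ a = 9 ∨ a = 10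
    · rw [if_pos ha, if_pos (hmem.2 ha), one_mul]
    · rw [if_neg ha, if_neg (fun h => ha (hmem.1 h)), zero_mul]
  rw [Finset.sum_congr rfl fun a _ => hterm a, Finset.sum_ite_mem, Finset.univ_inter,
    Finset.sum_insert (by decide), Finset.sum_insert (by decide), Finset.sum_singleton,
    cellMeanEnergy_emeryAtoms_8, cellMeanEnergy_emeryAtoms_9, cellMeanEnergy_emeryAtoms_10]
  ring

/-- **THE ELECTRON COUNT PER `CuO₂` OF EVERY EQUILIBRIUM FROM FOUR CERTIFIED PRESSURES** (`β, δ > 0`): a floor `L ≤ emeryPressure β θ` and caps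
`emeryPressure β (θ + δ·emeryLevelDir) ≤ U₊`, `emeryPressure β (θ − δ·emeryLevelDir) ≤ U₋` give
`4(L − U₊)/(βδ) ≤ ρ_Cu(ω) + ρ_{O_x}(ω) + ρ_{O_y}(ω) ≤ 4(U₋ − L)/(βδ)` for EVERY `2×2`-periodic equilibrium `ω` at `(β, θ)`.
[cite: Griffiths1964, Eq. (39) and Fig. 3] [cite: Israel1979, Thm. I.2.4] -/
theorem emery_electronCount_mem_Icc_of_bounds {β : ℝ} (hβ : 0 < β) {θ : Fin 14 → ℝ} {ω : InfVolFermionState 2}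
    (h : ω.IsPerVarEquilibrium β liebPeriods (emeryInteraction θ) 1) {δ : ℝ} (hδ : 0 < δ) {L Uplus Uminus : ℝ}
    (hL : L ≤ emeryPressure β θ) (hUp : emeryPressure β (θ + δ • emeryLevelDir) ≤ Uplus)
    (hUm : emeryPressure β (θ + (-δ) • emeryLevelDir) ≤ Uminus) :
    ω.densityAt cuSite + ω.densityAt oxSite + ω.densityAt oySite ∈ Set.Icc (4 * (L - Uplus) / (β * δ)) (4 * (Uminus - L) / (β * δ)) := by
  have hw := InfVolFermionState.IsPerVarEquilibrium.sum_mul_cellMeanEnergy_mem_Icc_of_bounds (Ψ₀ := hubbardFermionInteraction 2 0 0)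
    (Ψv := emeryAtoms) hβ h emeryLevelDir hδ hL hUp hUm
  rw [sum_emeryLevelDir_mul_cellMeanEnergy] at hw
  have hβδ : 0 < β * δ := mul_pos hβ hδ
  obtain ⟨h1, h2⟩ := hw
  constructor
  · rw [mul_div_assoc]; linarith
  · rw [mul_div_assoc]; linarith

/-- **THE Cu OCCUPATION OF EVERY EQUILIBRIUM FROM FOUR CERTIFIED PRESSURES** (`β, δ > 0`; direction = the Cu level `θ₈` alone):
`4(L − U₊)/(βδ) ≤ ρ_Cu(ω) ≤ 4(U₋ − L)/(βδ)`. [cite: Griffiths1964, Eq. (39) and Fig. 3] [cite: Israel1979, Thm. I.2.4] -/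
theorem emery_cuDensity_mem_Icc_of_bounds {β : ℝ} (hβ : 0 < β) {θ : Fin 14 → ℝ} {ω : InfVolFermionState 2}
    (h : ω.IsPerVarEquilibrium β liebPeriods (emeryInteraction θ) 1) {δ : ℝ} (hδ : 0 < δ) {L Uplus Uminus : ℝ}
    (hL : L ≤ emeryPressure β θ) (hUp : emeryPressure β (θ + Pi.single 8 δ) ≤ Uplus)
    (hUm : emeryPressure β (θ + Pi.single 8 (-δ)) ≤ Uminus) :
    ω.densityAt cuSite ∈ Set.Icc (4 * (L - Uplus) / (β * δ)) (4 * (Uminus - L) / (β * δ)) := by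
  have hw := emery_cellObservable_mem_Icc_of_bounds hβ h 8 hδ hL hUp hUm
  rw [cellMeanEnergy_emeryAtoms_8] at hw
  have hβδ : 0 < β * δ := mul_pos hβ hδ
  obtain ⟨h1, h2⟩ := hw
  constructor
  · rw [mul_div_assoc]; linarith
  · rw [mul_div_assoc]; linarith

end Literature.MathematicalPhysics.QuantumLattice

end
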